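import Literature.Geometry.Lorentzian.SpacetimeLocalConvergenceOfChartsExhaustion
import Literature.Geometry.Lorentzian.SpacetimeLocalConvergenceOfChartsFar
import HarnessLib

/-!
# The exhaustion datum carries its charts as converging far charts

Twin of `SpacetimeLocalConvergenceOfChartsFar.lean` for the datum `LocalSubconvergence.ofChartsExhaustion`
(charts good only on an exhaustion `W 0 ≤ W 1 ≤ ⋯` of the domain): the clause
`LocalSubconvergence.FarChartsConverge` holds with far charts the charts `Ψₙ` themselves and limit
far chart `id`, for ANY reference form on the chart domain — a compact part of the domain lies in
the good pieces of all late members of the subsequence, where the difference of the deviations is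
the difference of the components. Hence `SubconvergesLocallyWithFarChartsTo.ofChartsExhaustion`.

## References
* M. T. Anderson, Cheeger–Gromov theory and applications to general relativity, 2004, Def. 1.1. [Anderson2004]
* P. Petersen, *Riemannian Geometry*, 2nd ed., GTM 171, Springer 2006, Ch. 10, §3.2. [Petersen2006]
-/

noncomputable section

open Set Filter TopologicalSpace Function
open scoped Manifold ContDiff Topology ENNReal

universe u

namespace Literature.Geometry.Lorentzian

namespace Spacetime

namespace LocalSubconvergence

variable {𝓢ₙ : ℕ → Spacetime.{u} 4} {pₙ : ∀ n, (𝓢ₙ n).carrier}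

/-- A compact subset of the union of an increasing sequence of open sets of `E4` lies in one of
them. [folklore] -/
theorem exists_subset_of_isCompact_of_monotone_opens {W : ℕ → Opens E4} (hWm : Monotone W)
    {K : Set E4} (hK : IsCompact K) (hKU : K ⊆ ⋃ j, (W j : Set E4)) : ∃ j, K ⊆ (W j : Set E4) := by
  obtain ⟨T, hT⟩ := hK.elim_finite_subcover (fun j ↦ (W j : Set E4)) (fun j ↦ (W j).2) hKU
  refine ⟨T.sup id, hT.trans (iUnion₂_subset fun j hj ↦ hWm ?_)⟩
  exact Finset.le_sup (f := id) hj

/-- **The charts of `ofChartsExhaustion` converge as far charts, for any reference form** (module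
docstring). [cite: Anderson2004, Def. 1.1] -/
theorem farChartsConverge_ofChartsExhaustion (B : ModelBackground)
    (hO : IsConnected (B.domain : Set E4)) {y₀ : E4} (hy₀ : y₀ ∈ (B.domain : Set E4))
    (W : ℕ → Opens E4) (hWO : ∀ n, (W n : Set E4) ⊆ (B.domain : Set E4)) (hWm : Monotone W)
    (hWc : ∀ n, IsPreconnected (W n : Set E4)) (hW0 : y₀ ∈ (W 0 : Set E4))
    (hWU : ∀ y ∈ (B.domain : Set E4), ∃ n, y ∈ (W n : Set E4))
    (Ψ : ∀ n, B.domain → (𝓢ₙ n).carrier)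
    (hΨ : ∀ n, ContMDiffOn 𝓘(ℝ, E4) (𝓡 4) ∞ (Ψ n) (Subtype.val ⁻¹' (W n : Set E4)))
    (hinj : ∀ n, InjOn (Ψ n) (Subtype.val ⁻¹' (W n : Set E4)))
    (hcentre : ∀ n, Ψ n ⟨y₀, hy₀⟩ = pₙ n)
    (hfut : ∀ n, (𝓢ₙ n).timeOrientation.IsFutureDirected
      (mfderiv 𝓘(ℝ, E4) (𝓡 4) (Ψ n) ⟨y₀, hy₀⟩ (E4.basisVector 0)))
    (hpinch : ∀ n, ∀ y ∈ (W n : Set E4),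
      ‖(𝓢ₙ n).deviationExtend (Minkowski.backgroundOn B.domain) (Ψ n) y‖ < 1)
    (L : NearMinkowskiChart B.domain) {φ : ℕ → ℕ} (hφ : StrictMono φ) (k : ℕ)
    (hlim : ∀ K ⊆ (B.domain : Set E4), IsCompact K →
      Tendsto (fun m ↦ supCkENorm K k
        ((𝓢ₙ (φ m)).metricInCoords (Ψ (φ m) ∘ (chartAt E4 (⟨y₀, hy₀⟩ : B.domain)).symm) - L.G))
        atTop (𝓝 0)) :
    (ofChartsExhaustion hO hy₀ W hWO hWm hWc hW0 hWU Ψ hΨ hinj hcentre hfut hpinch L hφ k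
      hlim).FarChartsConverge B Ψ (id : B.domain → (L.spacetime hO).carrier) where
  eventually_embed_comp_eq _ _ _ := Eventually.of_forall fun _ _ _ ↦ rfl
  tendsto_supCkENorm_deviationExtend K hK hKO := by
    have hUnion : (⋃ j, (W j : Set E4)) = (B.domain : Set E4) :=
      Subset.antisymm (iUnion_subset hWO) fun y hy ↦ mem_iUnion.2 (hWU y hy)
    obtain ⟨j₀, hj₀⟩ := exists_subset_of_isCompact_of_monotone_opens hWm hK (by rw [hUnion]; exact hKO)
    have hKW : ∀ j, j₀ ≤ j → K ⊆ (W (φ j) : Set E4) := fun j hj ↦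
      hj₀.trans (hWm (hj.trans (hφ.id_le j)))
    refine (hlim K hKO hK).congr' ?_
    filter_upwards [eventually_ge_atTop j₀] with m hm
    refine supCkENorm_congr fun y hy ↦ ?_
    filter_upwards [(W (φ m)).2.mem_nhds (hKW m hm hy)] with z hz
    have hzO : z ∈ (B.domain : Set E4) := hWO _ hz
    have hd : MDifferentiableAt 𝓘(ℝ, E4) (𝓡 4) (Ψ (φ m)) ⟨z, hzO⟩ :=
      (𝓢ₙ (φ m)).mdifferentiableAt_of_contMDiffOn_preimage B (Ψ (φ m)) (W (φ m)).2 (hΨ _) hzO hz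
    have h1 := (𝓢ₙ (φ m)).metricInCoords_comp_chartAt_symm_sub_eq_deviation B (Ψ (φ m)) ⟨y₀, hy₀⟩
      hzO hd
    have h2 : (𝓢ₙ (φ m)).deviationExtend B (Ψ (φ m)) z = (𝓢ₙ (φ m)).deviation B (Ψ (φ m)) ⟨z, hzO⟩ :=
      (𝓢ₙ (φ m)).deviationExtend_coe B (Ψ (φ m)) ⟨z, hzO⟩
    have h3 := L.deviationExtend_id_background_of_mem B hO hzO
    show (𝓢ₙ (φ m)).metricInCoords (Ψ (φ m) ∘ (chartAt E4 (⟨y₀, hy₀⟩ : B.domain)).symm) z - L.G z =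
      (𝓢ₙ (φ m)).deviationExtend B (Ψ (φ m)) z -
        (L.spacetime hO).deviationExtend B (id : B.domain → (L.spacetime hO).carrier) z
    rw [h2, ← h1, h3]
    ext v w
    simp only [sub_apply]
    ring

end LocalSubconvergence

/-- **Subconvergence with far charts from charts good on an exhaustion.** [cite: Anderson2004, Def. 1.1] -/
theorem SubconvergesLocallyWithFarChartsTo.ofChartsExhaustion {𝓢ₙ : ℕ → Spacetime.{u} 4}
    {pₙ : ∀ n, (𝓢ₙ n).carrier} (B : ModelBackground) (hO : IsConnected (B.domain : Set E4))
    {y₀ : E4} (hy₀ : y₀ ∈ (B.domain : Set E4)) (W : ℕ → Opens E4)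
    (hWO : ∀ n, (W n : Set E4) ⊆ (B.domain : Set E4)) (hWm : Monotone W)
    (hWc : ∀ n, IsPreconnected (W n : Set E4)) (hW0 : y₀ ∈ (W 0 : Set E4))
    (hWU : ∀ y ∈ (B.domain : Set E4), ∃ n, y ∈ (W n : Set E4))
    (Ψ : ∀ n, B.domain → (𝓢ₙ n).carrier)
    (hΨ : ∀ n, ContMDiffOn 𝓘(ℝ, E4) (𝓡 4) ∞ (Ψ n) (Subtype.val ⁻¹' (W n : Set E4)))
    (hinj : ∀ n, InjOn (Ψ n) (Subtype.val ⁻¹' (W n : Set E4)))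
    (hcentre : ∀ n, Ψ n ⟨y₀, hy₀⟩ = pₙ n)
    (hfut : ∀ n, (𝓢ₙ n).timeOrientation.IsFutureDirected
      (mfderiv 𝓘(ℝ, E4) (𝓡 4) (Ψ n) ⟨y₀, hy₀⟩ (E4.basisVector 0)))
    (hpinch : ∀ n, ∀ y ∈ (W n : Set E4),
      ‖(𝓢ₙ n).deviationExtend (Minkowski.backgroundOn B.domain) (Ψ n) y‖ < 1)
    (L : NearMinkowskiChart B.domain) {φ : ℕ → ℕ} (hφ : StrictMono φ) {k : ℕ}
    (hlim : ∀ K ⊆ (B.domain : Set E4), IsCompact K →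
      Tendsto (fun m ↦ supCkENorm K k
        ((𝓢ₙ (φ m)).metricInCoords (Ψ (φ m) ∘ (chartAt E4 (⟨y₀, hy₀⟩ : B.domain)).symm) - L.G))
        atTop (𝓝 0)) :
    SubconvergesLocallyWithFarChartsTo 𝓢ₙ pₙ (L.spacetime hO) ⟨y₀, hy₀⟩ k B Ψ
      (id : B.domain → (L.spacetime hO).carrier) :=
  ⟨LocalSubconvergence.ofChartsExhaustion hO hy₀ W hWO hWm hWc hW0 hWU Ψ hΨ hinj hcentre hfut hpinch L hφ
      k hlim,
    LocalSubconvergence.farChartsConverge_ofChartsExhaustion B hO hy₀ W hWO hWm hWc hW0 hWU Ψ hΨ hinj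
      hcentre hfut hpinch L hφ k hlim⟩

end Spacetime

end Literature.Geometry.Lorentzian

end
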